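import Literature.NumberTheory.Sieve.SmoothRieszMeanSaddle
import HarnessLib

/-!
# `Ψ(x, y)` by the saddle-point method, up to constants (Hildebrand–Tenenbaum 1986, Theorem 1)

Topic `Literature/NumberTheory/Sieve`; a PROVED tool file toward
`Literature.NumberTheory.DiophantineGeometry.XYZUpperHalf` ([Harper2016, Cor. 1], whose proof (§2.1,
"Smooth Numbers Result 1") invokes the Hildebrand–Tenenbaum saddle-point theorem). From the two-sided
estimate for the Riesz mean `F_y(x) = Σ_{n ≤ x, n ∈ S(y)} (x - n)` (`smoothRieszMean_two_sided`) we pass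
to `Ψ(x, y) = #{n ≤ x : n ∈ S(y)}` by monotone differencing:
`h Ψ(x, y) ≤ F_y(x + h) - F_y(x)` and `F_y(x) - F_y(x') ≤ (x - x') Ψ(x, y)` (`x' ≤ x`).

## Main statements

* `mul_card_le_smoothRieszMean_sub`, `smoothRieszMean_sub_le_mul_card` — the differencing inequalities.
* `card_smoothNumbersUpTo_two_sided` — for `x ≥ x₀`, `(log x)^4 ≤ y`, `log y ≤ (log x)^{1/5}`, with
  `α = α(x, y)`: `(1/50) x^α ζ(α, y)/√φ₂(α, y) ≤ Ψ(x, y) ≤ 3 x^α ζ(α, y)/√φ₂(α, y)`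
  ([HildebrandTenenbaum1986, Thm 1]: `Ψ(x,y) = x^α ζ(α,y)/(α√(2πφ₂(α,y))) (1 + O(1/u + log y/y))`
  uniformly in `x ≥ y ≥ 2`; here up to absolute constants and in the stated range).

## References

* [HildebrandTenenbaum1986] A. Hildebrand, G. Tenenbaum, *On integers free of large prime factors*,
  Trans. Amer. Math. Soc. 296 (1986), 265–290, Theorem 1 and §4.
* [Harper2016] A. J. Harper, *Minor arcs, mean values, and restriction theory for exponential sums over
  smooth numbers*, Compos. Math. 152 (2016), 1121–1158, §2.1.
-/

noncomputable section

open Finset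

namespace Literature.NumberTheory.Sieve

variable {x x' h : ℝ} {y : ℕ}

/-- The finite set of `y`-smooth `n` with `0 < n ≤ x`. [folklore] -/
theorem smoothRieszMean_eq_sum_filter (x : ℝ) (y : ℕ) :
    smoothRieszMean x y = ∑ n ∈ (Finset.Ioc 0 ⌊x⌋₊).filter (· ∈ Nat.smoothNumbers (y + 1)), (x - (n : ℝ)) :=
  rfl

/-- The summation range of the Riesz mean is `Nat.smoothNumbersUpTo ⌊x⌋ (y+1)`. [folklore] -/
theorem filter_Ioc_eq_smoothNumbersUpTo (x : ℝ) (y : ℕ) :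
    (Finset.Ioc 0 ⌊x⌋₊).filter (· ∈ Nat.smoothNumbers (y + 1)) = Nat.smoothNumbersUpTo ⌊x⌋₊ (y + 1) := by
  ext n
  simp only [Finset.mem_filter, Finset.mem_Ioc, Nat.mem_smoothNumbersUpTo]
  constructor
  · rintro ⟨⟨-, h2⟩, h3⟩; exact ⟨h2, h3⟩
  · rintro ⟨h2, h3⟩; exact ⟨⟨Nat.pos_of_ne_zero h3.1, h2⟩, h3⟩

/-- Monotonicity of the summation range in `x`. [folklore] -/
theorem filter_Ioc_subset (hxx' : x' ≤ x) (y : ℕ) :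
    (Finset.Ioc 0 ⌊x'⌋₊).filter (· ∈ Nat.smoothNumbers (y + 1)) ⊆
      (Finset.Ioc 0 ⌊x⌋₊).filter (· ∈ Nat.smoothNumbers (y + 1)) :=
  Finset.filter_subset_filter _ (Finset.Ioc_subset_Ioc_right (Nat.floor_mono hxx'))

/-- The Riesz mean is non-negative. [folklore] -/
theorem smoothRieszMean_nonneg (hx : 0 ≤ x) (y : ℕ) : 0 ≤ smoothRieszMean x y := by
  rw [smoothRieszMean_eq_sum_filter]
  refine Finset.sum_nonneg fun n hn => ?_
  have h1 : n ≤ ⌊x⌋₊ := (Finset.mem_Ioc.1 (Finset.mem_filter.1 hn).1).2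
  have h2 : (n : ℝ) ≤ x := le_trans (by exact_mod_cast h1) (Nat.floor_le hx)
  linarith

/-- **Differencing, lower**: `h Ψ(x, y) ≤ F_y(x + h) - F_y(x)` (`x, h ≥ 0`).
[cite: HildebrandTenenbaum1986, §4 (proof of Thm 1 from Lemma 11)] -/
theorem mul_card_le_smoothRieszMean_sub (hx : 0 ≤ x) (hh : 0 ≤ h) (y : ℕ) :
    h * #(Nat.smoothNumbersUpTo ⌊x⌋₊ (y + 1)) ≤ smoothRieszMean (x + h) y - smoothRieszMean x y := by
  rw [← filter_Ioc_eq_smoothNumbersUpTo, smoothRieszMean_eq_sum_filter, smoothRieszMean_eq_sum_filter]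
  set S := (Finset.Ioc 0 ⌊x⌋₊).filter (· ∈ Nat.smoothNumbers (y + 1)) with hS
  set S' := (Finset.Ioc 0 ⌊x + h⌋₊).filter (· ∈ Nat.smoothNumbers (y + 1)) with hS'
  have hsub : S ⊆ S' := filter_Ioc_subset (by linarith) y
  have h1 : ∑ n ∈ S, (x + h - (n : ℝ)) ≤ ∑ n ∈ S', (x + h - (n : ℝ)) := by
    refine Finset.sum_le_sum_of_subset_of_nonneg hsub fun n hn _ => ?_
    have h3 : n ≤ ⌊x + h⌋₊ := (Finset.mem_Ioc.1 (Finset.mem_filter.1 hn).1).2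
    have h4 : (n : ℝ) ≤ x + h := le_trans (by exact_mod_cast h3) (Nat.floor_le (by linarith))
    linarith
  have h2 : ∑ n ∈ S, (x + h - (n : ℝ)) = ∑ n ∈ S, (x - (n : ℝ)) + h * #S := by
    rw [Finset.card_eq_sum_ones, Nat.cast_sum, Finset.mul_sum, ← Finset.sum_add_distrib]
    refine Finset.sum_congr rfl fun n _ => ?_
    push_cast; ring
  linarith

/-- **Differencing, upper**: `F_y(x) - F_y(x') ≤ (x - x') Ψ(x, y)` (`x' ≤ x`).
[cite: HildebrandTenenbaum1986, §4 (proof of Thm 1 from Lemma 11)] -/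
theorem smoothRieszMean_sub_le_mul_card (hxx' : x' ≤ x) (y : ℕ) :
    smoothRieszMean x y - smoothRieszMean x' y ≤ (x - x') * #(Nat.smoothNumbersUpTo ⌊x⌋₊ (y + 1)) := by
  rw [← filter_Ioc_eq_smoothNumbersUpTo, smoothRieszMean_eq_sum_filter, smoothRieszMean_eq_sum_filter]
  set S := (Finset.Ioc 0 ⌊x⌋₊).filter (· ∈ Nat.smoothNumbers (y + 1)) with hS
  set S' := (Finset.Ioc 0 ⌊x'⌋₊).filter (· ∈ Nat.smoothNumbers (y + 1)) with hS'
  have hsub : S' ⊆ S := filter_Ioc_subset hxx' y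
  -- `Σ_{S} (x' - n) ≤ Σ_{S'} (x' - n)`: the extra terms are negative
  have h1 : ∑ n ∈ S, (x' - (n : ℝ)) ≤ ∑ n ∈ S', (x' - (n : ℝ)) := by
    rw [← Finset.sum_sdiff hsub]
    have h3 : ∑ n ∈ S \ S', (x' - (n : ℝ)) ≤ 0 := by
      refine Finset.sum_nonpos fun n hn => ?_
      rw [Finset.mem_sdiff] at hn
      have hnS := hn.1
      have hnS' := hn.2
      have hsm : n ∈ Nat.smoothNumbers (y + 1) := (Finset.mem_filter.1 hnS).2
      have hn0 : 0 < n := (Finset.mem_Ioc.1 (Finset.mem_filter.1 hnS).1).1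
      have hgt : ⌊x'⌋₊ < n := by
        by_contra hle; push Not at hle
        exact hnS' (Finset.mem_filter.2 ⟨Finset.mem_Ioc.2 ⟨hn0, hle⟩, hsm⟩)
      have : x' < n := Nat.lt_of_floor_lt hgt
      linarith
    linarith
  have h2 : ∑ n ∈ S, (x - (n : ℝ)) = ∑ n ∈ S, (x' - (n : ℝ)) + (x - x') * #S := by
    rw [Finset.card_eq_sum_ones, Nat.cast_sum, Finset.mul_sum, ← Finset.sum_add_distrib]
    refine Finset.sum_congr rfl fun n _ => ?_
    push_cast; ring
  linarith

/-- `27 ≤ 8^{8/5}` (`27⁵ ≤ 8⁸`). [folklore] -/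
theorem twentyseven_le_eight_rpow : (27 : ℝ) ≤ 8 ^ (8 / 5 : ℝ) := by
  have h : (27 : ℝ) = (27 ^ (5 : ℝ)) ^ (1 / 5 : ℝ) := by
    rw [← Real.rpow_mul (by norm_num)]; norm_num
  have h2 : (8 : ℝ) ^ (8 / 5 : ℝ) = (8 ^ (8 : ℝ)) ^ (1 / 5 : ℝ) := by
    rw [← Real.rpow_mul (by norm_num)]; norm_num
  rw [h, h2]
  refine Real.rpow_le_rpow (by positivity) ?_ (by norm_num)
  rw [show (5 : ℝ) = (5 : ℕ) by norm_num, show (8 : ℝ) = ((8 : ℕ) : ℝ) by norm_num, Real.rpow_natCast,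
    Real.rpow_natCast]
  norm_num

/-- **Hildebrand–Tenenbaum's Theorem 1, up to absolute constants.** For `x ≥ x₀` and
`(log x)^4 ≤ y ≤ exp((log x)^{1/5})`, with `α = α(x, y)` the saddle point,
`(1/50) x^α ζ(α, y)/√φ₂(α, y) ≤ Ψ(x, y) ≤ 3 x^α ζ(α, y)/√φ₂(α, y)`, where
`Ψ(x, y) = #Nat.smoothNumbersUpTo ⌊x⌋ (y+1)` counts the `n ≤ x` all of whose prime factors are `≤ y`.
(Printed: `Ψ(x, y) = x^α ζ(α, y)/(α √(2π φ₂(α, y))) (1 + O(1/u + log y/y))` uniformly in `x ≥ y ≥ 2`;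
here up to constants, from `smoothRieszMean_two_sided` by differencing with steps `h = x` and `x' = x/8`.)
[cite: HildebrandTenenbaum1986, Thm 1] -/
theorem card_smoothNumbersUpTo_two_sided :
    ∃ x₀ : ℝ, ∀ (x : ℝ) (y : ℕ), x₀ ≤ x → Real.log x ^ 4 ≤ y → Real.log y ≤ Real.log x ^ (1 / 5 : ℝ) →
      1 / 50 * (x ^ saddlePoint x y * smoothZeta (saddlePoint x y) y /
          Real.sqrt (saddlePhi₂ (saddlePoint x y) y)) ≤ #(Nat.smoothNumbersUpTo ⌊x⌋₊ (y + 1)) ∧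
      (#(Nat.smoothNumbersUpTo ⌊x⌋₊ (y + 1)) : ℝ) ≤
        3 * (x ^ saddlePoint x y * smoothZeta (saddlePoint x y) y / Real.sqrt (saddlePhi₂ (saddlePoint x y) y)) := by
  obtain ⟨x₀, hF⟩ := smoothRieszMean_two_sided
  obtain ⟨x₁, hR⟩ := exists_saddle_range
  refine ⟨max (max x₀ x₁) 16, fun x y hx hy4 hylog => ?_⟩
  have hx₀ : x₀ ≤ x := le_trans (le_trans (le_max_left _ _) (le_max_left _ _)) hx
  have hx₁ : x₁ ≤ x := le_trans (le_trans (le_max_right _ _) (le_max_left _ _)) hx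
  have hx16 : 16 ≤ x := le_trans (le_max_right _ _) hx
  obtain ⟨hlow, hup⟩ := hF x y hx₀ hy4 hylog
  obtain ⟨hx1, hy2, hα35, hα1, hφ0, -, -, -⟩ := hR x y hx₁ hy4 hylog
  set α : ℝ := saddlePoint x y with hαdef
  set Φ : ℝ := Real.sqrt (saddlePhi₂ α y) with hΦ
  have hΦ0 : 0 < Φ := Real.sqrt_pos.2 hφ0
  have hx0 : 0 < x := by linarith
  have hζ0 : 0 < smoothZeta α y := smoothZeta_pos (by linarith)
  set G : ℝ := x ^ α * smoothZeta α y / Φ with hG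
  have hG0 : 0 < G := by positivity
  have hxpow : x ^ (1 + α) = x * x ^ α := by rw [Real.rpow_add hx0, Real.rpow_one]
  set Ψ : ℝ := (#(Nat.smoothNumbersUpTo ⌊x⌋₊ (y + 1)) : ℝ) with hΨ
  constructor
  · -- lower bound: `(7/8) x Ψ ≥ F(x) - F(x/8) ≥ (1/25 - 13/(25·27)) x G`
    have hx8 : 1 < x / 8 := by rw [lt_div_iff₀ (by norm_num)]; linarith
    have hdiff := smoothRieszMean_sub_le_mul_card (x' := x / 8) (x := x) (by linarith) y
    have hup8 := hup (x / 8) hx8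
    -- `(x/8)^{1+α} ≤ x^{1+α}/27`
    have hpow8 : (x / 8) ^ (1 + α) ≤ x ^ (1 + α) / 27 := by
      rw [Real.div_rpow hx0.le (by norm_num), div_le_div_iff₀ (by positivity) (by norm_num)]
      have h27 : (27 : ℝ) ≤ 8 ^ (1 + α) :=
        le_trans twentyseven_le_eight_rpow (Real.rpow_le_rpow_of_exponent_le (by norm_num) (by linarith))
      exact mul_le_mul_of_nonneg_left h27 (by positivity)
    have h1 : smoothRieszMean (x / 8) y ≤ 13 / 25 * (x ^ (1 + α) / 27 * smoothZeta α y / Φ) := by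
      refine le_trans hup8 (mul_le_mul_of_nonneg_left ?_ (by norm_num))
      exact div_le_div_of_nonneg_right (mul_le_mul_of_nonneg_right hpow8 hζ0.le) hΦ0.le
    have h2 : 1 / 25 * (x ^ (1 + α) * smoothZeta α y / Φ) - 13 / 25 * (x ^ (1 + α) / 27 * smoothZeta α y / Φ)
        ≤ (x - x / 8) * Ψ := by linarith
    rw [hxpow] at h2
    have h3 : 1 / 25 * (x * x ^ α * smoothZeta α y / Φ) - 13 / 25 * (x * x ^ α / 27 * smoothZeta α y / Φ) =
        x * ((1 / 25 - 13 / (25 * 27)) * G) := by rw [hG]; ring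
    rw [h3, show (x - x / 8) * Ψ = x * (7 / 8 * Ψ) by ring] at h2
    have h4 := le_of_mul_le_mul_left h2 hx0
    rw [hG] at h4 ⊢
    nlinarith [h4, hG0]
  · -- upper bound: `x Ψ ≤ F(2x) - F(x) ≤ F(2x) ≤ (13/25) 4 x G`
    have hdiff := mul_card_le_smoothRieszMean_sub (x := x) (h := x) hx0.le hx0.le y
    rw [show x + x = 2 * x by ring] at hdiff
    have hup2 := hup (2 * x) (by linarith)
    have hpow2 : (2 * x) ^ (1 + α) ≤ 4 * x ^ (1 + α) := by
      rw [Real.mul_rpow (by norm_num) hx0.le]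
      refine mul_le_mul_of_nonneg_right ?_ (by positivity)
      calc (2 : ℝ) ^ (1 + α) ≤ 2 ^ (2 : ℝ) := Real.rpow_le_rpow_of_exponent_le (by norm_num) (by linarith)
        _ = 4 := by norm_num
    have h1 : smoothRieszMean (2 * x) y ≤ 13 / 25 * (4 * x ^ (1 + α) * smoothZeta α y / Φ) := by
      refine le_trans hup2 (mul_le_mul_of_nonneg_left ?_ (by norm_num))
      exact div_le_div_of_nonneg_right (mul_le_mul_of_nonneg_right hpow2 hζ0.le) hΦ0.le
    have hF0 : 0 ≤ smoothRieszMean x y := smoothRieszMean_nonneg hx0.le y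
    have h2 : x * Ψ ≤ 13 / 25 * (4 * x ^ (1 + α) * smoothZeta α y / Φ) := by linarith
    rw [hxpow, show 13 / 25 * (4 * (x * x ^ α) * smoothZeta α y / Φ) = x * (52 / 25 * G) by rw [hG]; ring] at h2
    have h4 := le_of_mul_le_mul_left h2 hx0
    rw [hG] at h4 ⊢
    nlinarith [h4, hG0]

end Literature.NumberTheory.Sieve

end
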